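import Mathlib.MeasureTheory.Covering.Besicovitch
import Mathlib.MeasureTheory.Covering.BesicovitchVectorSpace
import Mathlib.MeasureTheory.Measure.Lebesgue.Complex
import Mathlib.MeasureTheory.Measure.Lebesgue.EqHaar
import Mathlib.MeasureTheory.Integral.Bochner.Set
import Mathlib.MeasureTheory.Function.LocallyIntegrable
import Mathlib.MeasureTheory.Group.Measure
import Mathlib.Analysis.Complex.Isometry
import Mathlib.Analysis.Complex.Circle
import Mathlib.Analysis.SpecialFunctions.Complex.Circle
import HarnessLib

/-!
# Existence of Wolff packing data (the hypothesis `(W)` of `ScrewLatticeWolff`)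

(rh-split-screw-bridge g13, cell rh-split; the paper half (i) of barrier candidate B16 in
`cards/SPLIT-screw-bridge.md` §18, made kernel.  Nothing in this file is a claim about `ζ` or about
the truth of RH: it is plane measure theory.)

**Theorem (`exists_wolffData`).**  For every `R > 1` there are countably many points `w` of the open
annulus `1 < |w| < R` and weights `α_w > 0` with `Σ α_w < ∞` such that

* `Σ_w α_w · w^k = 0` for every `k ≥ 1` (absolutely), and
* `sup_w |w|` is **not attained**: every `|w|` is exceeded by some `|w'|`.

This is Wolff's 1921 device (Ross–Shapiro, *Generalized analytic continuation*, §4.2, Lemma 4.2.4):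
exhaust the annulus up to a Lebesgue-null set by countably many disjoint closed discs
`D(w, r_w)` (Besicovitch/Vitali: `Besicovitch.exists_disjoint_closedBall_covering_ae`), put
`α_w := area D(w, r_w)`; the area mean-value property `∫_{D(w,r)} z^k dA = area · w^k` (proved here from
the translation and rotation invariance of plane measure, no polar coordinates) and
`∫_annulus z^k dA = 0` (rotation invariance) give `Σ α_w w^k = 0`.  Non-attainment is forced by
admitting only radii `r ≤ (R - |w|)/2`: if all centres had modulus `≤ ρ < R`, every disc would lie in
`|z| ≤ (R + ρ)/2` and the outer rim of the annulus, of positive measure, would be uncovered.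

Feeding `exists_wolffData` (index type `↥t`, `w := (↑)`, `α := α ∘ (↑)`) into
`ScrewLatticeWolff.modelPsi_latticePSD` discharges its hypothesis `hW`.
-/

set_option linter.dupNamespace false

open MeasureTheory Metric Set Complex
open scoped Real

namespace Summit.RiemannHypothesis.RiemannHypothesis.Theorems.Splittings.ScrewLatticeWolffData

/-! ## 1. Rotation invariance kills the moments `k ≥ 1` -/

/-- A power of the unit complex number `exp(iπ/k)` : `exp(iπ/k)^k = -1` for `k ≥ 1`. -/
theorem circleExp_pow_eq_neg_one {k : ℕ} (hk : 1 ≤ k) :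
    ((Circle.exp (π / k) : Circle) : ℂ) ^ k = -1 := by
  rw [Circle.coe_exp, ← Complex.exp_nat_mul]
  have hk' : (k : ℂ) ≠ 0 := by exact_mod_cast (Nat.one_le_iff_ne_zero.mp hk)
  have : (k : ℂ) * (((π / k : ℝ) : ℂ) * I) = π * I := by
    push_cast
    field_simp
  rw [this, Complex.exp_pi_mul_I]

/-- If a set `s ⊆ ℂ` is invariant under rotations, then `∫_s z^k dA = 0` for every `k ≥ 1`
(no integrability hypothesis is needed: both sides are junk together). -/
theorem setIntegral_pow_eq_zero {s : Set ℂ} (hs : ∀ (u : Circle) (z : ℂ), (u : ℂ) * z ∈ s ↔ z ∈ s)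
    {k : ℕ} (hk : 1 ≤ k) : ∫ z in s, z ^ k = 0 := by
  set u : Circle := Circle.exp (π / k) with hu_def
  have hu : (u : ℂ) ^ k = -1 := circleExp_pow_eq_neg_one hk
  have h1 : MeasurePreserving (rotation u) volume volume := (rotation u).measurePreserving
  have h2 : MeasurableEmbedding (rotation u) := (rotation u).toHomeomorph.measurableEmbedding
  have h3 := h1.setIntegral_preimage_emb h2 (fun z ↦ z ^ k) s
  have hpre : (rotation u) ⁻¹' s = s := by
    ext z
    simp only [mem_preimage, rotation_apply, hs]
  rw [hpre] at h3
  simp only [rotation_apply, mul_pow] at h3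
  rw [integral_const_mul, hu] at h3
  linear_combination (-(1:ℂ) / 2) * h3

/-- Closed discs centred at `0` are rotation invariant. -/
theorem mul_mem_closedBall_zero_iff (u : Circle) (z : ℂ) (r : ℝ) :
    (u : ℂ) * z ∈ closedBall (0 : ℂ) r ↔ z ∈ closedBall (0 : ℂ) r := by
  simp [mem_closedBall, dist_zero_right]

/-! ## 2. The area mean-value property of `z^k` on discs -/

/-- `∫_{D(w,r)} z^k dA = area(D(w,r)) · w^k`. -/
theorem setIntegral_closedBall_pow (w : ℂ) (r : ℝ) (k : ℕ) :
    ∫ z in closedBall w r, z ^ k = (volume.real (closedBall w r) : ℂ) * w ^ k := by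
  have h1 : MeasurePreserving (fun z : ℂ ↦ z + w) volume volume := measurePreserving_add_right volume w
  have h2 : MeasurableEmbedding (fun z : ℂ ↦ z + w) := (Homeomorph.addRight w).measurableEmbedding
  have h3 := h1.setIntegral_preimage_emb h2 (fun z ↦ z ^ k) (closedBall w r)
  have hpre : (fun z : ℂ ↦ z + w) ⁻¹' closedBall w r = closedBall 0 r := by
    ext z
    simp [mem_closedBall, dist_eq_norm]
  rw [hpre] at h3
  rw [← h3, Measure.addHaar_real_closedBall_center volume w r]
  simp_rw [add_pow]
  have hint : ∀ m ∈ Finset.range (k + 1),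
      Integrable (fun z : ℂ ↦ z ^ m * w ^ (k - m) * (k.choose m : ℂ)) (volume.restrict (closedBall 0 r)) := by
    intro m _
    exact ((continuous_pow m).mul continuous_const |>.mul continuous_const).continuousOn.integrableOn_compact
      (isCompact_closedBall 0 r)
  rw [integral_finsetSum _ hint, Finset.sum_eq_single 0]
  · simp only [pow_zero, one_mul, Nat.sub_zero, Nat.choose_zero_right, Nat.cast_one, mul_one]
    rw [setIntegral_const, Complex.real_smul]
  · intro m _ hm0
    have : ∫ z in closedBall (0:ℂ) r, z ^ m * w ^ (k - m) * (k.choose m : ℂ)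
        = (∫ z in closedBall (0:ℂ) r, z ^ m) * (w ^ (k - m) * (k.choose m : ℂ)) := by
      rw [← integral_mul_const]
      congr 1
      ext z
      ring
    rw [this, setIntegral_pow_eq_zero (fun u z ↦ mul_mem_closedBall_zero_iff u z r)
      (Nat.one_le_iff_ne_zero.mpr hm0), zero_mul]
  · intro h
    exact absurd (Finset.mem_range.mpr (Nat.succ_pos k)) h

/-! ## 3. Wolff data exist, with a non-attained supremum of moduli -/

/-- **Wolff packing data.**  For `R > 1` there are countably many `w` with `1 < |w| < R` and weights
`α_w > 0`, `Σ α_w < ∞`, such that `Σ_w α_w w^k = 0` for every `k ≥ 1` and `sup |w|` is not attained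
(in particular the family is nonempty, indeed infinite). -/
theorem exists_wolffData {R : ℝ} (hR : 1 < R) :
    ∃ (t : Set ℂ) (α : ℂ → ℝ), t.Countable ∧ t.Nonempty ∧
      (∀ w ∈ t, 1 < ‖w‖ ∧ ‖w‖ < R) ∧ (∀ w ∈ t, 0 < α w) ∧
      Summable (fun w : t ↦ α w) ∧
      (∀ k : ℕ, 1 ≤ k → HasSum (fun w : t ↦ (α w : ℂ) * (w : ℂ) ^ k) 0) ∧
      (∀ w ∈ t, ∃ w' ∈ t, ‖w‖ < ‖w'‖) := by
  set s : Set ℂ := {z | 1 < ‖z‖ ∧ ‖z‖ < R} with hs_def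
  set f : ℂ → Set ℝ := fun z ↦ {ρ | ρ ≤ (R - ‖z‖) / 2 ∧ ρ ≤ (‖z‖ - 1) / 2} with hf_def
  have hf : ∀ x ∈ s, ∀ δ > 0, (f x ∩ Ioo 0 δ).Nonempty := by
    intro x hx δ hδ
    obtain ⟨hx1, hx2⟩ := hx
    refine ⟨min (δ / 2) (min ((R - ‖x‖) / 2) ((‖x‖ - 1) / 2)), ⟨?_, ?_⟩, ?_, ?_⟩
    · exact (min_le_right _ _).trans (min_le_left _ _)
    · exact (min_le_right _ _).trans (min_le_right _ _)
    · exact lt_min (by linarith) (lt_min (by linarith) (by linarith))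
    · exact (min_le_left _ _).trans_lt (by linarith)
  obtain ⟨t, r, ht, hts, hr, hμ, hdisj⟩ :=
    Besicovitch.exists_disjoint_closedBall_covering_ae (volume : Measure ℂ) f s hf (fun _ ↦ 1)
      (fun _ _ ↦ one_pos)
  -- basic facts about the discs
  have hrpos : ∀ w ∈ t, 0 < r w := fun w hw ↦ (hr w hw).2.1
  have hrR : ∀ w ∈ t, r w ≤ (R - ‖w‖) / 2 := fun w hw ↦ (hr w hw).1.1
  have hr1 : ∀ w ∈ t, r w ≤ (‖w‖ - 1) / 2 := fun w hw ↦ (hr w hw).1.2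
  have hreach : ∀ w ∈ t, ∀ z ∈ closedBall w (r w), ‖z‖ ≤ (R + ‖w‖) / 2 ∧ (1 + ‖w‖) / 2 ≤ ‖z‖ := by
    intro w hw z hz
    rw [mem_closedBall, dist_eq_norm] at hz
    have h1 : ‖z‖ ≤ ‖w‖ + ‖z - w‖ := by
      calc ‖z‖ = ‖w + (z - w)‖ := by ring_nf
        _ ≤ ‖w‖ + ‖z - w‖ := norm_add_le _ _
    have h2 : ‖w‖ ≤ ‖z‖ + ‖z - w‖ := by
      calc ‖w‖ = ‖z - (z - w)‖ := by ring_nf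
        _ ≤ ‖z‖ + ‖z - w‖ := norm_sub_le _ _
    constructor <;> linarith [hrR w hw, hr1 w hw]
  have hball_sub : ∀ w ∈ t, closedBall w (r w) ⊆ s := by
    intro w hw z hz
    obtain ⟨h1, h2⟩ := hreach w hw z hz
    obtain ⟨hw1, hw2⟩ := hts hw
    exact ⟨by linarith, by linarith⟩
  haveI : Countable t := ht.to_subtype
  set B : t → Set ℂ := fun w ↦ closedBall (w : ℂ) (r w) with hB_def
  have hBmeas : ∀ i, MeasurableSet (B i) := fun i ↦ measurableSet_closedBall
  have hBdisj : Pairwise (Function.onFun Disjoint B) := by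
    intro i j hij
    exact hdisj i.2 j.2 (fun h ↦ hij (Subtype.ext h))
  have hU_eq : (⋃ x ∈ t, closedBall x (r x)) = ⋃ i, B i := by
    rw [hB_def]; exact biUnion_eq_iUnion t fun x _ ↦ closedBall x (r x)
  have hUs : (⋃ i, B i) ⊆ s := by
    rw [← hU_eq]
    exact iUnion₂_subset hball_sub
  have hs_sub : s ⊆ closedBall (0 : ℂ) R := by
    intro z hz
    rw [mem_closedBall, dist_zero_right]
    exact hz.2.le
  have hs_fin : volume s < ⊤ := (measure_mono hs_sub).trans_lt measure_closedBall_lt_top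
  set α : ℂ → ℝ := fun w ↦ volume.real (closedBall w (r w)) with hα_def
  -- a thin sub-annulus near the outer rim is open, nonempty and of positive measure
  have hrim : ∀ ρ, 1 ≤ ρ → ρ < R → 0 < volume {z : ℂ | (R + ρ) / 2 < ‖z‖ ∧ ‖z‖ < R} := by
    intro ρ hρ1 hρR
    have hVopen : IsOpen {z : ℂ | (R + ρ) / 2 < ‖z‖ ∧ ‖z‖ < R} := by
      have : {z : ℂ | (R + ρ) / 2 < ‖z‖ ∧ ‖z‖ < R} = (fun z : ℂ ↦ ‖z‖) ⁻¹' Ioo ((R + ρ) / 2) R := by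
        ext z; simp
      rw [this]
      exact isOpen_Ioo.preimage continuous_norm
    have hVne : ({z : ℂ | (R + ρ) / 2 < ‖z‖ ∧ ‖z‖ < R}).Nonempty := by
      refine ⟨(((R + ρ) / 2 + R) / 2 : ℝ), ?_, ?_⟩
      · show (R + ρ) / 2 < ‖(((((R + ρ) / 2 + R) / 2 : ℝ)) : ℂ)‖
        rw [Complex.norm_real, Real.norm_eq_abs, abs_of_pos (by linarith)]
        linarith
      · show ‖(((((R + ρ) / 2 + R) / 2 : ℝ)) : ℂ)‖ < R
        rw [Complex.norm_real, Real.norm_eq_abs, abs_of_pos (by linarith)]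
        linarith
    exact hVopen.measure_pos volume hVne
  refine ⟨t, α, ht, ?_, fun w hw ↦ hts hw, ?_, ?_, ?_, ?_⟩
  · -- nonempty: an empty packing would leave the whole annulus (positive measure) uncovered
    by_contra hemp
    rw [not_nonempty_iff_eq_empty] at hemp
    have hV : {z : ℂ | (R + 1) / 2 < ‖z‖ ∧ ‖z‖ < R} ⊆ s \ ⋃ x ∈ t, closedBall x (r x) := by
      intro z hz
      rw [hemp]
      simp only [mem_iUnion, exists_prop, mem_empty_iff_false, false_and, exists_false,
        not_false_eq_true, mem_sdiff, and_true]
      exact ⟨by linarith [hz.1], hz.2⟩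
    have h0 := hrim 1 le_rfl hR
    have : volume {z : ℂ | (R + 1) / 2 < ‖z‖ ∧ ‖z‖ < R} ≤ 0 := by
      calc volume {z : ℂ | (R + 1) / 2 < ‖z‖ ∧ ‖z‖ < R}
          ≤ volume (s \ ⋃ x ∈ t, closedBall x (r x)) := measure_mono hV
        _ = 0 := hμ
    exact absurd this (not_le.mpr h0)
  · -- positivity of the weights
    intro w hw
    rw [hα_def]
    simp only [measureReal_def]
    exact ENNReal.toReal_pos (measure_closedBall_pos volume w (hrpos w hw)).ne'
      measure_closedBall_lt_top.ne
  · -- summability: Σ area = area of the union ≤ area of the annulus < ∞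
    have hmeas : volume (⋃ i, B i) = ∑' i, volume (B i) := measure_iUnion hBdisj hBmeas
    have hne : ∑' i, volume (B i) ≠ ⊤ := by
      rw [← hmeas]
      exact ((measure_mono hUs).trans_lt hs_fin).ne
    have := ENNReal.summable_toReal hne
    simpa [hα_def, hB_def, measureReal_def] using this
  · -- the Wolff identity Σ α_w w^k = 0, k ≥ 1
    intro k hk
    have hint : IntegrableOn (fun z : ℂ ↦ z ^ k) (⋃ i, B i) volume :=
      ((continuous_pow k).continuousOn.integrableOn_compact (isCompact_closedBall (0:ℂ) R)).mono_set
        (hUs.trans hs_sub)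
    have hsum := hasSum_integral_iUnion hBmeas hBdisj hint
    have hae : (⋃ i, B i) =ᵐ[volume] s := by
      refine ae_eq_set.mpr ⟨?_, ?_⟩
      · exact measure_mono_null (fun z hz ↦ (hz.2 (hUs hz.1)).elim) measure_empty
      · rw [← hU_eq]; exact hμ
    have hrot : ∀ (u : Circle) (z : ℂ), (u : ℂ) * z ∈ s ↔ z ∈ s := by
      intro u z
      simp [hs_def]
    rw [setIntegral_congr_set hae, setIntegral_pow_eq_zero hrot hk] at hsum
    have hterm : (fun i : t ↦ ∫ z in B i, z ^ k) = fun i : t ↦ (α i : ℂ) * (i : ℂ) ^ k := by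
      funext i
      rw [hB_def, hα_def]
      exact setIntegral_closedBall_pow (i : ℂ) (r i) k
    rw [hterm] at hsum
    exact hsum
  · -- the supremum of the moduli is not attained
    intro w hw
    by_contra hcon
    push Not at hcon
    set ρ : ℝ := ‖w‖ with hρ_def
    have hρR : ρ < R := (hts hw).2
    have hρ1 : 1 < ρ := (hts hw).1
    have hVsub : {z : ℂ | (R + ρ) / 2 < ‖z‖ ∧ ‖z‖ < R} ⊆ s \ ⋃ x ∈ t, closedBall x (r x) := by
      intro z hz
      obtain ⟨hz1, hz2⟩ := hz
      refine ⟨⟨by linarith, hz2⟩, ?_⟩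
      rw [hU_eq]
      intro hzU
      obtain ⟨i, hi⟩ := mem_iUnion.mp hzU
      have h1 := (hreach i i.2 z hi).1
      have h2 := hcon i i.2
      linarith
    have hVpos := hrim ρ hρ1.le hρR
    have : volume {z : ℂ | (R + ρ) / 2 < ‖z‖ ∧ ‖z‖ < R} ≤ 0 := by
      calc volume {z : ℂ | (R + ρ) / 2 < ‖z‖ ∧ ‖z‖ < R}
          ≤ volume (s \ ⋃ x ∈ t, closedBall x (r x)) := measure_mono hVsub
        _ = 0 := hμ
    exact absurd this (not_le.mpr hVpos)

end Summit.RiemannHypothesis.RiemannHypothesis.Theorems.Splittings.ScrewLatticeWolffData
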